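import Summits.Ventures.LatticeQCDFlow.Scaling.PlaquetteCorrelatorFloor
import Summits.Ventures.LatticeQCDFlow.Scaling.SUNCrossCutFloor
import Summits.Ventures.LatticeQCDFlow.Scaling.U1CrossCutFloorAllT
import Summits.Ventures.LatticeQCDFlow.Scaling.ConjecturesRepaired

/-!
HONEST FRAMING: exact (Metropolis-corrected) sampling algorithms for lattice gauge theory; figures
of merit are autocorrelation/cost numbers at stated couplings and volumes; no continuum-physics
claim.

# ClusteringFloorStrongCoupling — THE VENTURE'S CLUSTERING FLOOR (U″) `Conjectures.ClusteringFloor`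
# FOR TEMPORAL SEPARATIONS OF SPATIAL PLAQUETTES, AT STRONG COUPLING, FOR EVERY GAUGE GROUP WITH
# ONE-LINK DATA — `SU(N)` (`N ≥ 2`) AND `U(1)` — UNIFORMLY IN THE SEPARATION AND THE VOLUME
# (lean-1 GEN-11, ours; part 4 of 4)

Venture-side (OURS). Cell `lqcd-flow` (pub-lqcd), unit `pub-lqcd-lean-1-g11`, 2026-08-23.

(U″) `Conjectures.ClusteringFloor d N G ρ β i j a` (THEORY-2 §3.1, typed v1.6; status 'C at
intermediate β, theorem at strong coupling (cluster expansion)' — but NOT in the tree: the tree's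
strong-coupling floors `CrossCutCorrelatorFloor` of gens 8–10 hold at FIXED separation `2R + 1` with
an `R`-dependent `β₀`, and the Literature cluster expansion `UniformTorusClustering` is an UPPER
bound) asks for `κ₀ e^{−s/ξ} ≤ |⟨P_x P_{x+s e_a}⟩ − ⟨P_x⟩⟨P_{x+s e_a}⟩|` for ALL `s ≤ L/4`, all sites,
all `L ≥ L₀`, with `κ₀, ξ` INDEPENDENT of `s` and `L`.  This file proves it for `a = 0` (time) and
spatial plaquettes `0 < i < j` WITHOUT any expansion, from two tree inputs:

  (1) REFLECTION POSITIVITY ⇒ LOG-CONVEXITY: `g(n)² ≤ g(n−1) g(n+1)`, `1 ≤ n ≤ L − 2`, on every torus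
      `L ≥ 3`, `β ≥ 0` (`PlaquetteCorrelatorLogConvex`, `PlaquetteCorrelatorFloor`), hence
      `g(n) ≥ g(0)(g(1)/g(0))ⁿ ≥ δ (δ/N²)ⁿ` as soon as `g(1) ≥ δ > 0` (`tCorr_ge_geometric`);
  (2) (U′) AT `R = 0` (gens 8–10: `crossCutCorrelatorFloor_of_oneLink`, `_sun`, `_u1_all`):
      `|g(1)| ≥ δ` uniformly in `L ≥ L₀` for `0 < |β| ≤ β₀`; with `g(1) ≥ 0` from reflection
      positivity, `g(1) ≥ δ`.

* `clusteringFloor_of_crossCut` — for continuous `ρ`, `β > 0`, `i, j ≠ 0`: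
  `CrossCutCorrelatorFloor d N G ρ β 0 i j 0 → ClusteringFloor d N G ρ β i j 0`, with
  `κ₀ = δ`, `ξ = 1/log(2N²/δ + 2)`, `L₀' = max L₀ 3` (and the repaired form `…R`).
* **`clusteringFloor_of_oneLink`** — for every compact second-countable `G` and `ρ` with one-link
  data `OneLink ρ θ` (gen-10), `0 < i < j`: `∃ β₀ > 0, ∀ β ∈ (0, β₀], ClusteringFloor d N G ρ β i j 0`.
* **`clusteringFloor_sun`** (`SU(N)`, fundamental, `N ≥ 2`) and **`clusteringFloor_u1`** (`U(1)`).

Numbers (value-free reading): the rate is `ξ⁻¹ = log(2N²/δ + 2)` with `δ = |b|·β⁴/2` the gen-8/10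
floor at separation one (`b = Nθ⁵`, `θ = 1/2N` for `SU(N ≥ 3)`): `ξ⁻¹ ≈ 4 log(1/β) + O(1)` — the
strong-coupling shape `m ≍ −4 log β` of the plaquette–plaquette mass, as a LOWER bound on
correlations (the tree's `UniformTorusClustering` gives the matching upper-bound shape).
NOT CLAIMED: temporal plaquettes or spatial separations (an axis permutation of the tree would
transport `a = 0` to any `a ∉ {i, j}`; not done); intermediate `β` (there (U″) stays a CONJECTURE:
the floor `g(1) ≥ δ` uniformly in `L` is the open input — the log-convexity half holds at every
`β ≥ 0`); `β < 0`; sharp constants.  Literature grade (cell rule): known mechanism (reflection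
positivity ⇒ monotone correlation ratios; strong-coupling expansion for the first ratio); new typing
and a new docking (the venture's (U″) decided at strong coupling in the tree); nothing cited as fact.
-/

noncomputable section

namespace Summit.Ventures.LatticeQCDFlow.Theory2.Clustering

open MeasureTheory Literature.MathematicalPhysics.QuantumFieldTheory
open Literature.MathematicalPhysics.QuantumLattice (fundamentalRep continuous_fundamentalRep u1Rep
  continuous_u1Rep)
open Summit.Ventures.LatticeQCDFlow.Conjectures

/-! ## §1 From the cross-cut floor at separation one to the clustering floor -/

section General

variable {d N : ℕ} [NeZero d] {G : Type} [Group G] [TopologicalSpace G] [IsTopologicalGroup G]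
  [CompactSpace G] [MeasurableSpace G] [BorelSpace G] [SecondCountableTopology G]
  (ρ : G →* Matrix (Fin N) (Fin N) ℂ)

omit [SecondCountableTopology G] in
/-- **The conjecture's correlator is the timed correlator of the time-zero translate**: for every
site `x` and separation `s` in the time direction,
`⟨P_x P_{x + s e₀}⟩ − ⟨P_x⟩⟨P_{x + s e₀}⟩ = g_{x₀}(s)` with `x₀ = x − (x 0) e₀`. -/
theorem conjCorr_eq_tCorr {L : ℕ} [NeZero L] (β : ℝ) (x : Site d L) (i j : Fin d) (s : ℕ) :
    wilsonExpectation ρ β (fun U : GaugeConfig d L G =>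
        (ρ (plaquetteHolonomy U x i j)).trace.re
          * (ρ (plaquetteHolonomy U (x + Pi.single 0 ((s : ℕ) : ZMod L)) i j)).trace.re)
      - wilsonExpectation ρ β (fun U : GaugeConfig d L G => (ρ (plaquetteHolonomy U x i j)).trace.re)
        * wilsonExpectation ρ β (fun U : GaugeConfig d L G =>
          (ρ (plaquetteHolonomy U (x + Pi.single 0 ((s : ℕ) : ZMod L)) i j)).trace.re)
      = tCorr ρ β (x - Pi.single (0 : Fin d) (x 0)) i j ((s : ℕ) : ZMod L) := by
  set x₀ : Site d L := x - Pi.single (0 : Fin d) (x 0) with hx₀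
  have hx : x₀ + Pi.single (0 : Fin d) (x 0) = x := by rw [hx₀, sub_add_cancel]
  have e1 : (fun U : GaugeConfig d L G => (ρ (plaquetteHolonomy U x i j)).trace.re)
      = tObs ρ x₀ i j (x 0) := by
    funext U; unfold tObs; rw [hx]
  have e2 : (fun U : GaugeConfig d L G =>
        (ρ (plaquetteHolonomy U (x + Pi.single 0 ((s : ℕ) : ZMod L)) i j)).trace.re)
      = tObs ρ x₀ i j (x 0 + ((s : ℕ) : ZMod L)) := by
    funext U; unfold tObs; rw [Pi.single_add, ← add_assoc, hx]
  have e3 : (fun U : GaugeConfig d L G => (ρ (plaquetteHolonomy U x i j)).trace.re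
        * (ρ (plaquetteHolonomy U (x + Pi.single 0 ((s : ℕ) : ZMod L)) i j)).trace.re)
      = fun U => tObs ρ x₀ i j (x 0) U * tObs ρ x₀ i j (x 0 + ((s : ℕ) : ZMod L)) U := by
    funext U; rw [← e1, ← e2]
  rw [e3, e1, e2, expect_Pobs_mul, expect_Pobs ρ β x₀ i j (x 0),
    expect_Pobs ρ β x₀ i j (x 0 + ((s : ℕ) : ZMod L)), add_sub_cancel_left]
  unfold tCorr
  rw [expect_Pobs ρ β x₀ i j ((s : ℕ) : ZMod L)]

/-- **(U′) AT SEPARATION ONE IN TIME ⇒ (U″) IN TIME.**  For continuous `ρ`, `β > 0` and a spatial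
orientation `i, j ≠ 0`: if the cross-cut floor at `R = 0` along the time direction holds, then
`Conjectures.ClusteringFloor d N G ρ β i j 0` holds, with `κ₀ = δ`, `ξ = 1/log(2N²/δ + 2)`,
`L₀' = max L₀ 3` (reflection positivity ⇒ log-convexity ⇒ geometric floor). -/
theorem clusteringFloor_of_crossCut (hρ : Continuous ρ) {β : ℝ} (hβ : 0 < β) {i j : Fin d}
    (hi : i ≠ 0) (hj : j ≠ 0) (hU : CrossCutCorrelatorFloor d N G ρ β 0 i j 0) :
    ClusteringFloor d N G ρ β i j 0 := by
  obtain ⟨δ, hδ, L₀, hU⟩ := hU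
  set A : ℝ := 2 * (N : ℝ) ^ 2 / δ + 2 with hA
  have hA2 : 2 ≤ A := by
    have : 0 ≤ 2 * (N : ℝ) ^ 2 / δ := by positivity
    linarith
  have hApos : 0 < A := by linarith
  have hlog : 0 < Real.log A := Real.log_pos (by linarith)
  refine ⟨δ, hδ, 1 / Real.log A, by positivity, max L₀ 3, ?_⟩
  intro L _ hL s hs x
  have hL3 : 3 ≤ L := le_of_max_le_right hL
  have hL0 : L₀ ≤ L := le_of_max_le_left hL
  set x₀ : Site d L := x - Pi.single (0 : Fin d) (x 0) with hx₀
  have hx₀0 : x₀ 0 = 0 := by simp [hx₀]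
  -- (i) `δ ≤ g(1)` from the cross-cut floor at the time-zero base and reflection positivity
  have h1 : δ ≤ tCorr ρ β x₀ i j 1 := by
    have h := hU L hL0 x₀
    rw [conjCorr_eq_tCorr ρ β x₀ i j (2 * 0 + 1)] at h
    have e0 : x₀ - Pi.single (0 : Fin d) (x₀ 0) = x₀ := by rw [hx₀0, Pi.single_zero, sub_zero]
    rw [e0] at h
    norm_num at h
    have hnn := corr_one_nonneg ρ (by omega : 2 ≤ L) hρ hβ.le hx₀0 hi hj
    rwa [abs_of_nonneg hnn] at h
  -- (ii) the geometric floor on this torus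
  have hfloor := tCorr_ge_geometric ρ hL3 hρ hβ.le hx₀0 hi hj hδ h1 (n := s) (by omega)
  -- (iii) `N ≥ 1` (else `g ≡ 0`) and `1/A ≤ δ/N²`
  have hN2 : 0 < (N : ℝ) ^ 2 := by
    have := tCorr_zero_le ρ hρ β x₀ i j
    have := tCorr_one_le_zero ρ hρ β x₀ i j
    linarith
  have hq : A⁻¹ ≤ δ / (N : ℝ) ^ 2 := by
    rw [inv_eq_one_div, div_le_div_iff₀ hApos hN2, hA]
    have : (2 * (N : ℝ) ^ 2 / δ + 2) * δ = 2 * (N : ℝ) ^ 2 + 2 * δ := by field_simp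
    nlinarith [this]
  -- (iv) `κ₀ e^{−s/ξ} = δ A^{−s} ≤ δ (δ/N²)^s ≤ g(s) = the conjecture's correlator`
  have hexp : Real.exp (-((s : ℝ) / (1 / Real.log A))) = (A⁻¹) ^ s := by
    rw [div_div_eq_mul_div, div_one, Real.exp_neg, Real.exp_nat_mul, Real.exp_log hApos, inv_pow]
  rw [hexp, conjCorr_eq_tCorr ρ β x i j s]
  calc δ * (A⁻¹) ^ s ≤ δ * (δ / (N : ℝ) ^ 2) ^ s :=
        mul_le_mul_of_nonneg_left (pow_le_pow_left₀ (inv_nonneg.2 hApos.le) hq s) hδ.le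
    _ ≤ tCorr ρ β x₀ i j ((s : ℕ) : ZMod L) := hfloor
    _ ≤ |tCorr ρ β x₀ i j ((s : ℕ) : ZMod L)| := le_abs_self _

/-- The repaired item (U″-R) follows in the same way (the guard `0 < β` is one of its
hypotheses). -/
theorem clusteringFloorR_of_crossCut (hρ : Continuous ρ) {β : ℝ} {i j : Fin d} (hi : i ≠ 0)
    (hj : j ≠ 0) (hU : CrossCutCorrelatorFloor d N G ρ β 0 i j 0) :
    ClusteringFloorR d N G ρ β i j 0 :=
  fun _ _ hβ _ => clusteringFloor_of_crossCut ρ hρ hβ hi hj hU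

/-- **(U″) AT STRONG COUPLING FOR EVERY GAUGE GROUP WITH ONE-LINK DATA** (gen-10's
`GroupLayer.OneLink ρ θ`: `U(1)`, `SU(N)`, …): for spatial plaquettes `0 < i < j` separated in time
there is `β₀ > 0` such that `Conjectures.ClusteringFloor d N G ρ β i j 0` holds for every
`β ∈ (0, β₀]` — a clustering floor `κ₀ e^{−s/ξ}` uniform in the separation `s ≤ L/4`, the site and
the volume `L ≥ L₀`. -/
theorem clusteringFloor_of_oneLink [NeZero N] {θ : ℝ} (h : GroupLayer.OneLink ρ θ) {i j : Fin d}
    (hij : i < j) (hi : i ≠ 0) :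
    ∃ β₀ : ℝ, 0 < β₀ ∧ ∀ β : ℝ, 0 < β → β ≤ β₀ → ClusteringFloor d N G ρ β i j 0 := by
  have hj : j ≠ 0 := by
    intro h0
    have := Fin.lt_def.1 hij
    rw [h0, Fin.val_zero] at this
    omega
  obtain ⟨β₀, hβ₀, hcc⟩ := GroupLayer.crossCutCorrelatorFloor_of_oneLink h hij hi.symm hj.symm 0
  exact ⟨β₀, hβ₀, fun β hβ hle => clusteringFloor_of_crossCut ρ h.cont hβ hi hj
    (hcc β hβ.ne' (by rwa [abs_of_pos hβ]))⟩

end General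

/-! ## §2 Instances: `SU(N)` and `U(1)` -/

section Instances

variable {d N : ℕ} [NeZero d] {i j : Fin d}

/-- **(U″) AT STRONG COUPLING FOR `SU(N)`, `N ≥ 2`, FUNDAMENTAL REPRESENTATION** (spatial
plaquettes `0 < i < j`, temporal separations): `∃ β₀ > 0, ∀ β ∈ (0, β₀],
Conjectures.ClusteringFloor d N SU(N) (fundamentalRep (Fin N)) β i j 0`. -/
theorem clusteringFloor_sun (hN : 2 ≤ N) (hij : i < j) (hi : i ≠ 0) :
    ∃ β₀ : ℝ, 0 < β₀ ∧ ∀ β : ℝ, 0 < β → β ≤ β₀ →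
      ClusteringFloor d N (Matrix.specialUnitaryGroup (Fin N) ℂ) (fundamentalRep (Fin N)) β i j 0 := by
  haveI := GroupLayer.secondCountableTopology_SU N
  have hj : j ≠ 0 := by
    intro h0
    have := Fin.lt_def.1 hij
    rw [h0, Fin.val_zero] at this
    omega
  obtain ⟨β₀, hβ₀, hcc⟩ := GroupLayer.crossCutCorrelatorFloor_sun (d := d) hN hij hi.symm hj.symm 0
  exact ⟨β₀, hβ₀, fun β hβ hle => clusteringFloor_of_crossCut (fundamentalRep (Fin N))
    (continuous_fundamentalRep (Fin N)) hβ hi hj (hcc β hβ.ne' (by rwa [abs_of_pos hβ]))⟩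

/-- **(U″) AT STRONG COUPLING FOR `U(1)`** (spatial plaquettes `0 < i < j`, temporal separations):
`∃ β₀ > 0, ∀ β ∈ (0, β₀], Conjectures.ClusteringFloor d 1 U(1) u1Rep β i j 0`. -/
theorem clusteringFloor_u1 (hij : i < j) (hi : i ≠ 0) :
    ∃ β₀ : ℝ, 0 < β₀ ∧ ∀ β : ℝ, 0 < β → β ≤ β₀ → ClusteringFloor d 1 Circle u1Rep β i j 0 := by
  have hj : j ≠ 0 := by
    intro h0
    have := Fin.lt_def.1 hij
    rw [h0, Fin.val_zero] at this
    omega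
  obtain ⟨β₀, hβ₀, hcc⟩ := Lattice.U1Layer.crossCutCorrelatorFloor_u1_all (d := d) hij hi.symm hj.symm 0
  exact ⟨β₀, hβ₀, fun β hβ hle => clusteringFloor_of_crossCut u1Rep continuous_u1Rep hβ hi hj
    (hcc β hβ.ne' (by rwa [abs_of_pos hβ]))⟩

end Instances

end Summit.Ventures.LatticeQCDFlow.Theory2.Clustering
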